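import Literature.NumberTheory.LFunctions.SmoothedExplicitFormulaContour
import Literature.NumberTheory.LFunctions.TrivialZerosSimple
import HarnessLib

/-!
# The smoothed explicit formula of Heath-Brown, Ford and Kadiri, V: the remainder as the sum over the trivial zeros

Topic `Literature/NumberTheory/LFunctions`. Everything in this file is PROVED (no named fact);
one auxiliary definition (`SmoothedEF.farLeftJ`, the line integral on `Re w = −2K − 1/2`).

The tree's exact explicit formula for the mollified prime sum `K_f(s) = Σ Λ(n) f(log n) n^{-s}`
(Ford 2002, Lemma 4.5 = Kadiri 2005, Thm. 3.1; `SmoothedEF.fordK_eq_explicit`,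
`SmoothedExplicitFormulaContour.lean`) reads, for an admissible smoothing `f`
(`IsSmoothedEFTest`) and `−1/2 < Re s < 3/2`, `s ≠ 1`, `ζ(s) ≠ 0`,

  `K_f(s) = −f(0) ζ'/ζ(s) + F₀(s−1) − Σ_ρ m(ρ) F₀(s−ρ) + J(s)`,
  `J(s) = (1/2πi) ∫_{(−1/2)} (−ζ'/ζ)(w) F₀(s − w) dw`   (`smoothedEFRemainder`).

Ford bounds `J` through his Lemma 3.2 (`|ζ'/ζ(−1/2+iu)| ≤ 4.62 + ½ log(1+u²/9)`):
`|J(s)| ≤ D(1.72 + ⅓ log(1 + Im s))`. Here we instead EVALUATE `J` by moving the line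
`Re w = −1/2` to `Re w = −2K − 1/2` and letting `K → ∞` (de la Vallée Poussin's treatment of
the trivial zeros; template: the tree's `ExplicitFormulaPsiOneTrivialZeros.lean` for `ψ₁`):

* `SmoothedEF.hasSum_smoothedEFRemainder_trivialZeros` — **`J(s) = −Σ_{k ≥ 1} F₀(s + 2k)`**
  (`−1/2 < Re s`), absolutely convergent (the trivial zeros are simple:
  `riemannZetaZeroOrder_trivialZero`, `TrivialZerosSimple.lean`);
* `SmoothedEF.fordK_eq_explicit_trivialZeros` — the explicit formula with the trivial zeros:
  `K_f(s) = −f(0) ζ'/ζ(s) + F₀(s−1) − Σ_ρ m(ρ) F₀(s−ρ) − Σ_{k≥1} F₀(s+2k)`;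
* `SmoothedEF.norm_smoothedEFRemainder_le` — **`|J(s)| ≤ D/4` for `Re s ≥ 1`** whenever
  `|F₀(z)| ≤ D/|z|²` on `Re z ≥ 0`, `|z| ≥ η` (Ford's (4.5)) with `η ≤ 2`
  (`Σ_{k≥1} 1/(2k+1)² ≤ Σ 1/(2k(2k+2)) = 1/4`), a replacement for Ford's
  `D(1.72 + ⅓ log(1 + Im s))` in Lemma 4.5 that is uniform in `Im s`.

On the way (needed for `K → ∞`, where a bound for `ζ'/ζ` on `Re w = −2K − 1/2` growing only
logarithmically in `K` is required): a digamma bound uniform up to the real axis,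
`‖ψ(w)‖ ≤ log(1 + ‖w‖) + 13` for `Re w ≥ 3/4` (`norm_digamma_le_log_uniform`), hence
`‖ξ'/ξ(s)‖ ≤ C + log(1 + ‖s‖)` on `Re s ≥ 3/2` and
`‖ζ'/ζ(−2K − 1/2 + it)‖ ≤ C + 2 log(K+1) + 2 log(1+|t|)`
(`exists_norm_logDeriv_riemannZeta_farLeft_le_log`).

## References

* K. Ford, *Zero-free regions for the Riemann zeta function*, Number Theory for the Millennium
  II (Urbana 2000), A K Peters 2002 = arXiv:1910.08205, Lemma 4.5 and its proof ((4.7)–(4.8)),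
  Lemma 3.2. (`Ford2002Millennium`)
* H. L. Montgomery, R. C. Vaughan, *Multiplicative Number Theory I*, CUP 2007, §12.1.1
  Exercises 6 and 8(b) (the trivial zeros in the explicit formula; simplicity).
  (`MontgomeryVaughan2007`)
* H. Kadiri, Acta Arith. 117 (2005) = arXiv:math/0401238, Thm. 3.1. (`Kadiri2005`)
-/

noncomputable section

open Complex Real MeasureTheory Set Filter Topology
open scoped ComplexConjugate

namespace Literature.NumberTheory.LFunctions

namespace SmoothedEF

/-! ## A digamma bound uniform up to the real axis -/

/-- `Σ_{k<n} 1/(k+a)² ≤ 1/a² + 1/a` for `a > 0` (telescoping `1/(k+a)² ≤ 1/(k−1+a) − 1/(k+a)`).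
[folklore] -/
theorem sum_inv_add_sq_le {a : ℝ} (ha : 0 < a) (n : ℕ) :
    ∑ k ∈ Finset.range n, 1 / ((k : ℝ) + a) ^ 2 ≤ 1 / a ^ 2 + 1 / a := by
  rcases Nat.eq_zero_or_pos n with rfl | hn
  · simp; positivity
  obtain ⟨m, rfl⟩ : ∃ m, n = m + 1 := ⟨n - 1, by omega⟩
  rw [Finset.sum_range_succ']
  simp only [Nat.cast_add, Nat.cast_one, Nat.cast_zero, zero_add]
  have hle : ∀ k ∈ Finset.range m,
      1 / ((k : ℝ) + 1 + a) ^ 2 ≤ 1 / ((k : ℝ) + a) - 1 / ((k : ℝ) + 1 + a) := by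
    intro k _
    have hk : (0 : ℝ) ≤ k := k.cast_nonneg
    have h1 : 0 < (k : ℝ) + a := by linarith
    have h2 : 0 < (k : ℝ) + 1 + a := by linarith
    rw [div_sub_div _ _ h1.ne' h2.ne', div_le_div_iff₀ (by positivity) (by positivity)]
    nlinarith
  have hsum := Finset.sum_le_sum hle
  have htel : ∀ n : ℕ, ∑ k ∈ Finset.range n, (1 / ((k : ℝ) + a) - 1 / ((k : ℝ) + 1 + a)) =
      1 / a - 1 / ((n : ℝ) + a) := by
    intro n
    induction n with
    | zero => simp
    | succ n ih => rw [Finset.sum_range_succ, ih]; push_cast; ring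
  rw [htel m] at hsum
  have hpos : 0 ≤ 1 / ((m : ℝ) + a) := by positivity
  linarith

/-- **Uniform digamma bound on `Re w ≥ 3/4`**: `‖ψ(w)‖ ≤ log(1 + ‖w‖) + 13`, for ALL
imaginary parts (the tree's logarithmic bound `norm_digamma_le_log` for `|Im w| ≥ 1/2`, and
for `|Im w| < 1/2` a comparison with the point `w + i` through the series
`ψ(w) + γ = Σ (1/(k+1) − 1/(w+k))`: `‖ψ(w) − ψ(w+i)‖ ≤ Σ 1/(Re w + k)² ≤ 28/9`). [folklore] -/
theorem norm_digamma_le_log_uniform {w : ℂ} (hw : 3 / 4 ≤ w.re) :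
    ‖digamma w‖ ≤ Real.log (1 + ‖w‖) + 13 := by
  have hw0 : 0 < w.re := by linarith
  by_cases him : 1 / 2 ≤ |w.im|
  · have := Literature.Analysis.SpecialFunctions.Complex.norm_digamma_le_log hw0 him
    linarith
  push Not at him
  set w' : ℂ := w + I with hw'
  have hw're : w'.re = w.re := by simp [hw']
  have hw'im : w'.im = w.im + 1 := by simp [hw']
  have hw'0 : 0 < w'.re := by rw [hw're]; exact hw0
  -- the bound at `w'`
  have h1 : ‖digamma w'‖ ≤ Real.log (1 + ‖w'‖) + 8 := by
    refine Literature.Analysis.SpecialFunctions.Complex.norm_digamma_le_log hw'0 ?_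
    rw [hw'im]
    have := (abs_lt.1 him).1
    rw [abs_of_pos (by linarith)]
    linarith
  have hnorm' : ‖w'‖ ≤ ‖w‖ + 1 := by
    rw [hw']; exact (norm_add_le _ _).trans (by simp)
  have hlog : Real.log (1 + ‖w'‖) ≤ Real.log (1 + ‖w‖) + 1 := by
    have h2 : Real.log (1 + ‖w'‖) ≤ Real.log (2 * (1 + ‖w‖)) :=
      Real.log_le_log (by positivity) (by linarith [norm_nonneg w])
    rw [Real.log_mul (by norm_num) (by positivity)] at h2
    linarith [Real.log_two_lt_d9]
  -- the series comparison `ψ(w) − ψ(w') = Σ (1/(w'+k) − 1/(w+k))`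
  have hs := Literature.Analysis.SpecialFunctions.Complex.hasSum_one_div_sub_one_div_digamma hw0
  have hs' := Literature.Analysis.SpecialFunctions.Complex.hasSum_one_div_sub_one_div_digamma hw'0
  have hdiff : HasSum (fun k : ℕ ↦ 1 / (w' + k) - 1 / (w + k)) (digamma w - digamma w') := by
    have := hs.sub hs'
    have e1 : (fun k : ℕ ↦ 1 / (w' + k) - 1 / (w + k)) =
        fun b : ℕ ↦ 1 / ((b : ℂ) + 1) - 1 / (w + b) - (1 / ((b : ℂ) + 1) - 1 / (w' + b)) := by
      funext k; ring
    have e2 : digamma w - digamma w' = digamma w + Real.eulerMascheroniConstant -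
        (digamma w' + Real.eulerMascheroniConstant) := by ring
    rw [e1, e2]
    exact this
  -- termwise bound by `1/(Re w + k)²`
  have hterm : ∀ k : ℕ, ‖1 / (w' + k) - 1 / (w + k)‖ ≤ 1 / ((k : ℝ) + w.re) ^ 2 := by
    intro k
    have hk : (0 : ℝ) ≤ k := k.cast_nonneg
    have hwk : 0 < (w + k).re := by simp; linarith
    have hwk' : 0 < (w' + k).re := by simp [hw']; linarith
    have hne : w + k ≠ 0 := fun h ↦ by rw [h] at hwk; simp at hwk
    have hne' : w' + k ≠ 0 := fun h ↦ by rw [h] at hwk'; simp at hwk'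
    have heq : 1 / (w' + k) - 1 / (w + k) = (w - w') / ((w' + k) * (w + k)) := by
      field_simp; ring
    rw [heq, norm_div, norm_mul]
    have hww' : ‖w - w'‖ = 1 := by simp [hw']
    rw [hww']
    have hn1 : (k : ℝ) + w.re ≤ ‖w + k‖ := by
      have := Complex.re_le_norm (w + k); simp at this; linarith
    have hn2 : (k : ℝ) + w.re ≤ ‖w' + k‖ := by
      have := Complex.re_le_norm (w' + k); simp [hw'] at this; linarith
    have hpos : 0 < (k : ℝ) + w.re := by linarith
    rw [sq]
    exact one_div_le_one_div_of_le (by positivity) (mul_le_mul hn2 hn1 hpos.le (norm_nonneg _))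
  -- summing up
  have hbd : ∀ n : ℕ, ∑ k ∈ Finset.range n, 1 / ((k : ℝ) + w.re) ^ 2 ≤ 28 / 9 := by
    intro n
    refine (sum_inv_add_sq_le hw0 n).trans ?_
    have h1 : 1 / w.re ^ 2 ≤ 16 / 9 := by
      rw [div_le_div_iff₀ (by positivity) (by norm_num)]; nlinarith
    have h2 : 1 / w.re ≤ 4 / 3 := by
      rw [div_le_div_iff₀ hw0 (by norm_num)]; linarith
    linarith
  have hsumm : Summable fun k : ℕ ↦ 1 / ((k : ℝ) + w.re) ^ 2 :=
    summable_of_sum_range_le (fun _ ↦ by positivity) hbd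
  have htsum : ∑' k : ℕ, 1 / ((k : ℝ) + w.re) ^ 2 ≤ 28 / 9 :=
    Real.tsum_le_of_sum_range_le (fun _ ↦ by positivity) hbd
  have hnormdiff : ‖digamma w - digamma w'‖ ≤ 28 / 9 := by
    rw [← hdiff.tsum_eq]
    refine (norm_tsum_le_tsum_norm ?_).trans ?_
    · exact hsumm.of_nonneg_of_le (fun _ ↦ norm_nonneg _) hterm
    · exact ((hsumm.of_nonneg_of_le (fun _ ↦ norm_nonneg _) hterm).tsum_le_tsum hterm hsumm).trans
        htsum
  have : ‖digamma w‖ ≤ ‖digamma w - digamma w'‖ + ‖digamma w'‖ := by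
    have := norm_add_le (digamma w - digamma w') (digamma w'); simpa using this
  linarith

/-! ## `ξ'/ξ` on `Re s ≥ 3/2`, all imaginary parts -/

/-- **`‖ξ'/ξ(s)‖ ≤ C + log(1 + ‖s‖)` on the half-plane `Re s ≥ 3/2`** (all `Im s`), from
`ξ'/ξ = 1/s + 1/(s−1) − ½ log π + ½ ψ(s/2) − Σ Λ(n) n^{−s}` and the uniform digamma bound.
[folklore] -/
theorem exists_norm_logDeriv_riemannXi_le_log :
    ∃ C : ℝ, 0 < C ∧ ∀ s : ℂ, 3 / 2 ≤ s.re → ‖logDeriv riemannXi s‖ ≤ C + Real.log (1 + ‖s‖) := by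
  set M : ℝ := ∑' n : ℕ, ‖LSeries.term (fun n ↦ (ArithmeticFunction.vonMangoldt n : ℂ))
    (3 / 2 : ℂ) n‖ with hM
  have hM0 : 0 ≤ M := tsum_nonneg fun _ ↦ norm_nonneg _
  refine ⟨M + 11, by positivity, fun s hs ↦ ?_⟩
  have hre : 1 < s.re := by linarith
  rw [logDeriv_riemannXi_eq_of_one_lt_re hre]
  have hns : 3 / 2 ≤ ‖s‖ := hs.trans (Complex.re_le_norm s)
  have h1 : ‖1 / s‖ ≤ 2 / 3 := by
    rw [norm_div, norm_one, div_le_div_iff₀ (by linarith) (by norm_num)]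
    linarith
  have h2 : ‖1 / (s - 1)‖ ≤ 2 := by
    rw [norm_div, norm_one]
    have : (1 / 2 : ℝ) ≤ ‖s - 1‖ := by
      have h := Complex.re_le_norm (s - 1)
      simp only [sub_re, one_re] at h
      linarith
    rw [div_le_iff₀ (by linarith)]
    linarith
  have hπ : ‖(-(Real.log π : ℂ)) / 2‖ ≤ 1 := by
    rw [norm_div, norm_neg, Complex.norm_real, Real.norm_eq_abs, Complex.norm_two,
      abs_of_pos (Real.log_pos (by linarith [Real.pi_gt_three]))]
    linarith [log_pi_lt_two]
  have h4 : ‖LSeries (fun n ↦ (ArithmeticFunction.vonMangoldt n : ℂ)) s‖ ≤ M :=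
    ZetaZeroSum.norm_LSeries_vonMangoldt_le_of_re_ge hs
  have hw : 3 / 4 ≤ (s / 2).re := by simp; linarith
  have hψ : ‖(1 / 2 : ℂ) * digamma (s / 2)‖ ≤ Real.log (1 + ‖s‖) + 13 / 2 := by
    rw [norm_mul, show ‖(1 / 2 : ℂ)‖ = 1 / 2 by simp]
    have h := norm_digamma_le_log_uniform hw
    have hn : ‖s / 2‖ ≤ ‖s‖ := by
      rw [norm_div, Complex.norm_two]; linarith [norm_nonneg s]
    have hl : Real.log (1 + ‖s / 2‖) ≤ Real.log (1 + ‖s‖) :=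
      Real.log_le_log (by positivity) (by linarith)
    have hl0 : 0 ≤ Real.log (1 + ‖s‖) := Real.log_nonneg (by linarith [norm_nonneg s])
    nlinarith
  calc ‖1 / s + 1 / (s - 1) + (-(Real.log π : ℂ) / 2 + 1 / 2 * digamma (s / 2)) -
        LSeries (fun n ↦ (ArithmeticFunction.vonMangoldt n : ℂ)) s‖
      ≤ ‖1 / s‖ + ‖1 / (s - 1)‖ + (‖-(Real.log π : ℂ) / 2‖ + ‖1 / 2 * digamma (s / 2)‖) +
          ‖LSeries (fun n ↦ (ArithmeticFunction.vonMangoldt n : ℂ)) s‖ := by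
        refine (norm_sub_le _ _).trans ?_
        gcongr
        refine (norm_add_le _ _).trans ?_
        gcongr
        · exact norm_add_le _ _
        · exact norm_add_le _ _
    _ ≤ 2 / 3 + 2 + (1 + (Real.log (1 + ‖s‖) + 13 / 2)) + M := by gcongr
    _ ≤ M + 11 + Real.log (1 + ‖s‖) := by linarith

/-! ## `ζ'/ζ` on the far-left lines `Re w = −2K − 1/2`, with logarithmic growth in `K` -/

/-- `Σ_{i ≤ K} 1/(i + 1/4) ≤ 6 + log(K + 1)` (`1/(n + 5/4) = 1 − (4n+1)/(4n+5) ≤ log((4n+5)/(4n+1))`,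
telescoping to `4 + log(4K + 1)`). [folklore] -/
theorem sum_inv_add_quarter_le (K : ℕ) :
    ∑ i ∈ Finset.range (K + 1), 1 / ((i : ℝ) + 1 / 4) ≤ 6 + Real.log ((K : ℝ) + 1) := by
  have key : ∀ n : ℕ, ∑ i ∈ Finset.range (n + 1), 1 / ((i : ℝ) + 1 / 4) ≤
      4 + Real.log (4 * (n : ℝ) + 1) := by
    intro n
    induction n with
    | zero => simp
    | succ n ih =>
      rw [Finset.sum_range_succ]
      have hn : (0 : ℝ) ≤ n := n.cast_nonneg
      have hstep : 1 / ((((n + 1 : ℕ)) : ℝ) + 1 / 4) ≤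
          Real.log (4 * (((n + 1 : ℕ) : ℝ)) + 1) - Real.log (4 * (n : ℝ) + 1) := by
        push_cast
        have h1 : 0 < 4 * (n : ℝ) + 1 := by linarith
        have h2 : 0 < 4 * ((n : ℝ) + 1) + 1 := by linarith
        rw [← Real.log_div h2.ne' h1.ne']
        have hx : 0 < (4 * ((n : ℝ) + 1) + 1) / (4 * (n : ℝ) + 1) := by positivity
        have := Real.one_sub_inv_le_log_of_pos hx
        rw [inv_div] at this
        have e : 1 - (4 * (n : ℝ) + 1) / (4 * ((n : ℝ) + 1) + 1) = 1 / ((n : ℝ) + 1 + 1 / 4) := by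
          field_simp; ring
        rwa [e] at this
      linarith
  have hK : (0 : ℝ) ≤ K := K.cast_nonneg
  have hlog : Real.log (4 * (K : ℝ) + 1) ≤ Real.log 4 + Real.log ((K : ℝ) + 1) := by
    rw [← Real.log_mul (by norm_num) (by linarith)]
    exact Real.log_le_log (by linarith) (by linarith)
  have hlog4 : Real.log 4 ≤ 2 := by
    rw [show (4 : ℝ) = 2 * 2 by norm_num, Real.log_mul two_ne_zero two_ne_zero]
    linarith [Real.log_two_lt_d9]
  linarith [key K]

/-- **`ζ'/ζ` on the far-left line `Re s = −2K − 1/2` with logarithmic growth in `K`**: there is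
`C` with `‖ζ'/ζ(−2K−1/2 + it)‖ ≤ C + 2 log(K+1) + 2 log(1+|t|)` for all `K ≥ 1` and real `t`
(`ζ'/ζ = ξ'/ξ − 1/s − 1/(s−1) − Γ_ℝ'/Γ_ℝ`, `|ξ'/ξ(s)| = |ξ'/ξ(1−s̄)|` and the uniform bound on
`Re ≥ 3/2`, `ψ(s/2) = ψ(s/2 + K + 1) − Σ_{j ≤ K} 1/(s/2 + j)` with `Σ_{j ≤ K} 1/|s/2+j| ≤
Σ_{i ≤ K} 1/(i + 1/4) ≤ 6 + log(K+1)`). Compare the tree's `PsiOneExplicit.norm_logDeriv_riemannZeta_farLeft_le`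
(linear in `K`). [folklore] -/
theorem exists_norm_logDeriv_riemannZeta_farLeft_le_log :
    ∃ C : ℝ, 0 < C ∧ ∀ K : ℕ, 1 ≤ K → ∀ t : ℝ,
      ‖deriv riemannZeta (((-(2 * (K : ℝ)) - 1 / 2 : ℝ) : ℂ) + t * I) /
          riemannZeta (((-(2 * (K : ℝ)) - 1 / 2 : ℝ) : ℂ) + t * I)‖ ≤
        C + 2 * Real.log ((K : ℝ) + 1) + 2 * Real.log (1 + |t|) := by
  obtain ⟨Cξ, hCξ0, hCξ⟩ := exists_norm_logDeriv_riemannXi_le_log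
  refine ⟨Cξ + 14, by positivity, fun K hK t ↦ ?_⟩
  have hK1 : (1 : ℝ) ≤ K := by exact_mod_cast hK
  set σ : ℝ := -(2 * (K : ℝ)) - 1 / 2 with hσ
  set s : ℂ := (σ : ℂ) + t * I with hs
  have hsre : s.re = σ := by simp [hs]
  have hsim : s.im = t := by simp [hs]
  have hnotint : ∀ n : ℕ, σ ≠ -(2 * (n : ℝ)) := by
    intro n h
    have h2 : (4 : ℝ) * ((n : ℝ) - K) = 1 := by rw [hσ] at h; linarith
    have h3 : (4 * ((n : ℤ) - K) : ℤ) = 1 := by exact_mod_cast h2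
    omega
  have hpole : ∀ n : ℕ, s ≠ -(2 * (n : ℂ)) := by
    intro n h
    exact hnotint n (by simpa [hsre] using congrArg Complex.re h)
  have h1 : s ≠ 1 := fun h ↦ by
    have := congrArg Complex.re h; rw [hsre] at this; simp at this; rw [hσ] at this; linarith
  have hζ : riemannZeta s ≠ 0 := by
    intro hz
    obtain ⟨n, hn⟩ := (riemannZeta_eq_zero_iff_of_re_nonpos (by rw [hsre, hσ]; linarith)).1 hz
    have := congrArg Complex.re hn
    rw [hsre] at this; simp at this
    exact hnotint (n + 1) (by rw [this]; push_cast; ring)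
  rw [PsiOneExplicit.logDeriv_riemannZeta_eq_of_ne_gammaPole hpole h1 hζ]
  have hlog0 : 0 ≤ Real.log (1 + |t|) := Real.log_nonneg (by linarith [abs_nonneg t])
  have hlogK0 : 0 ≤ Real.log ((K : ℝ) + 1) := Real.log_nonneg (by linarith)
  -- `ξ'/ξ` by reflection: the point `1 - σ + it = 2K + 3/2 + it`
  have hξ : ‖logDeriv riemannXi s‖ ≤ Cξ + 2 + Real.log ((K : ℝ) + 1) + Real.log (1 + |t|) := by
    rw [hs, norm_logDeriv_riemannXi_reflect]
    set s' : ℂ := ((1 - σ : ℝ) : ℂ) + t * I with hs'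
    have hre' : 3 / 2 ≤ s'.re := by simp [hs', hσ]; linarith
    have hn : ‖s'‖ ≤ 2 * K + 3 / 2 + |t| := by
      calc ‖s'‖ ≤ |s'.re| + |s'.im| := Complex.norm_le_abs_re_add_abs_im _
        _ = (1 - σ) + |t| := by
            simp [hs', abs_of_pos (by rw [hσ]; linarith : (0 : ℝ) < 1 - σ)]
        _ = 2 * K + 3 / 2 + |t| := by rw [hσ]; ring
    have h := hCξ s' hre'
    have hl : Real.log (1 + ‖s'‖) ≤ Real.log ((3 * ((K : ℝ) + 1)) * (1 + |t|)) :=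
      Real.log_le_log (by positivity) (by nlinarith [abs_nonneg t, norm_nonneg s'])
    rw [Real.log_mul (by positivity) (by positivity), Real.log_mul (by norm_num) (by positivity)]
      at hl
    have hl3 : Real.log 3 ≤ 2 := by
      have := Real.log_le_sub_one_of_pos (by norm_num : (0 : ℝ) < 3); linarith
    linarith
  -- `1/s`, `1/(s-1)`
  have hns : (1 / 2 : ℝ) ≤ ‖s‖ := by
    have := Complex.abs_re_le_norm s; rw [hsre, hσ] at this
    have h' : (1 / 2 : ℝ) ≤ |-(2 * (K : ℝ)) - 1 / 2| := by
      rw [abs_of_neg (by linarith)]; linarith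
    exact h'.trans this
  have hns1 : (1 : ℝ) ≤ ‖s - 1‖ := by
    have h := Complex.abs_re_le_norm (s - 1)
    have hre1 : (s - 1).re = σ - 1 := by simp [hsre]
    rw [hre1, hσ] at h
    have h' : (1 : ℝ) ≤ |-(2 * (K : ℝ)) - 1 / 2 - 1| := by
      rw [abs_of_neg (by linarith)]; linarith
    exact h'.trans h
  have h1s : ‖1 / s‖ ≤ 2 := by
    rw [norm_div, norm_one, div_le_iff₀ (by linarith)]; linarith
  have h1s1 : ‖1 / (s - 1)‖ ≤ 1 := by
    rw [norm_div, norm_one, div_le_iff₀ (by linarith)]; linarith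
  -- `Γ_ℝ'/Γ_ℝ(s) = -log π/2 + ψ(s/2)/2`, `ψ(s/2) = ψ(3/4 + it/2) - ∑_{j ≤ K} 1/(s/2 + j)`
  have hΓ : ‖logDeriv Gammaℝ s‖ ≤
      1 + (9 + Real.log (1 + |t|) + (6 + Real.log ((K : ℝ) + 1))) / 2 := by
    have hpole2 : ∀ m : ℕ, s / 2 ≠ -m := fun m h ↦ hpole m (by linear_combination 2 * h)
    rw [logDeriv_Gammaℝ hpole2, ← Complex.ofReal_log Real.pi_pos.le]
    have hshift := PsiOneExplicit.norm_digamma_le_shift hpole2 (K + 1)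
    have hw : s / 2 + ((K + 1 : ℕ) : ℂ) = ((3 / 4 : ℝ) : ℂ) + (t / 2 : ℝ) * I := by
      rw [hs, hσ]; push_cast; ring
    rw [hw] at hshift
    have h34 := PsiOneExplicit.norm_digamma_three_quarters_le t
    have hterms : ∑ j ∈ Finset.range (K + 1), ‖(s / 2 + (j : ℂ))⁻¹‖ ≤
        6 + Real.log ((K : ℝ) + 1) := by
      have hle : ∀ j ∈ Finset.range (K + 1),
          ‖(s / 2 + (j : ℂ))⁻¹‖ ≤ 1 / (((K - j : ℕ) : ℝ) + 1 / 4) := by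
        intro j hj
        rw [Finset.mem_range] at hj
        have hjK : j ≤ K := Nat.lt_succ_iff.1 hj
        have hjK' : (j : ℝ) ≤ K := by exact_mod_cast hjK
        rw [norm_inv, Nat.cast_sub hjK]
        have hre : |(s / 2 + (j : ℂ)).re| ≤ ‖s / 2 + (j : ℂ)‖ := Complex.abs_re_le_norm _
        have hre' : (s / 2 + (j : ℂ)).re = (j : ℝ) - K - 1 / 4 := by
          simp [hsre, hσ]; ring
        have hq : (K : ℝ) - j + 1 / 4 = |(j : ℝ) - K - 1 / 4| := by
          rw [abs_of_neg (by linarith)]; ring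
        rw [one_div, hq, ← hre']
        exact inv_anti₀ (by rw [hre', ← hq]; linarith) hre
      refine (Finset.sum_le_sum hle).trans ?_
      have hrefl := Finset.sum_range_reflect (fun i : ℕ ↦ 1 / ((i : ℝ) + 1 / 4)) (K + 1)
      simp only [Nat.add_sub_cancel] at hrefl
      rw [hrefl]
      exact sum_inv_add_quarter_le K
    have hπ : ‖(-(Real.log π : ℂ)) / 2‖ ≤ 1 := by
      rw [norm_div, norm_neg, Complex.norm_real, Real.norm_eq_abs, Complex.norm_two,
        abs_of_pos (Real.log_pos (by linarith [Real.pi_gt_three]))]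
      linarith [log_pi_lt_two]
    calc ‖-(Real.log π : ℂ) / 2 + digamma (s / 2) / 2‖
        ≤ ‖-(Real.log π : ℂ) / 2‖ + ‖digamma (s / 2) / 2‖ := norm_add_le _ _
      _ ≤ 1 + (9 + Real.log (1 + |t|) + (6 + Real.log ((K : ℝ) + 1))) / 2 := by
          gcongr
          rw [norm_div, Complex.norm_two]
          linarith
  calc ‖logDeriv riemannXi s - 1 / s - 1 / (s - 1) - logDeriv Gammaℝ s‖
      ≤ ‖logDeriv riemannXi s‖ + ‖1 / s‖ + ‖1 / (s - 1)‖ + ‖logDeriv Gammaℝ s‖ := by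
        refine (norm_sub_le _ _).trans ?_
        gcongr
        refine (norm_sub_le _ _).trans ?_
        gcongr
        exact norm_sub_le _ _
    _ ≤ (Cξ + 2 + Real.log ((K : ℝ) + 1) + Real.log (1 + |t|)) + 2 + 1 +
        (1 + (9 + Real.log (1 + |t|) + (6 + Real.log ((K : ℝ) + 1))) / 2) := by gcongr
    _ ≤ Cξ + 14 + 2 * Real.log ((K : ℝ) + 1) + 2 * Real.log (1 + |t|) := by linarith

/-! ## The contour identity on `[−2K − 1/2, −1/2] × [−T, T]` -/

/-- **Residues of `G = (−ζ'/ζ)(w) F₀(s − w)` in `Re w ≤ −1/2`**: for `−1/2 < Re s`, `K ≥ 1`,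
`T ≥ 1`, the boundary integral of `G` over `[−2K−1/2, −1/2] × [−T, T]` is
`2πi Σ_{k<K} m(−2(k+1)) · (−F₀(s + 2(k+1)))` — the weighted argument principle for `ζ`
(analytic and, off the trivial zeros `−2, …, −2K`, non-zero on the closed rectangle) with the
analytic weight `−F₀(s − w)`. [cite: Ford2002Millennium, Lemma 4.5 (proof)]
[cite: MontgomeryVaughan2007, §12.1.1 Exercise 6] -/
theorem contour_identity_farLeft {f : ℝ → ℝ} {x₀ : ℝ} (hfc : Continuous f) (hx₀ : 0 ≤ x₀)
    (hf0 : ∀ u, x₀ ≤ u → f u = 0) {s : ℂ} (hσ₁ : -(1 / 2) < s.re) {K : ℕ} (hK : 1 ≤ K)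
    {T : ℝ} (hT : 1 ≤ T) :
    Literature.Analysis.Complex.rectBoundaryIntegral (smoothedEFIntegrand f s)
        (-(2 * (K : ℝ)) - 1 / 2) (-(1 / 2)) (-T) T =
      2 * π * I * ∑ k ∈ Finset.range K,
        (riemannZetaZeroOrder (-2 * ((k : ℂ) + 1)) : ℂ) * -fordLaplace₀ f (s - -2 * ((k : ℂ) + 1)) := by
  have hK1 : (1 : ℝ) ≤ K := by exact_mod_cast hK
  set a : ℝ := -(2 * (K : ℝ)) - 1 / 2 with ha
  have hab : a < -(1 / 2) := by rw [ha]; linarith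
  have hcd : -T < T := by linarith
  set g : ℂ → ℂ := fun w ↦ -fordLaplace₀ f (s - w) with hg
  have hfun : smoothedEFIntegrand f s = fun w ↦ deriv riemannZeta w / riemannZeta w * g w := by
    funext w; simp only [smoothedEFIntegrand, hg]; ring
  -- `g` is analytic off `w = s`, in particular on `Re w ≤ -1/2`
  have hgd : DifferentiableOn ℂ g {w : ℂ | w ≠ s} := fun w hw ↦
    ((differentiableAt_fordLaplace₀ hfc hx₀ hf0 (sub_ne_zero.2 (Ne.symm hw))).comp w
      ((differentiableAt_const _).sub differentiableAt_id)).neg.differentiableWithinAt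
  have hga : ∀ w : ℂ, w.re ≤ -(1 / 2) → AnalyticAt ℂ g w := fun w hw ↦
    hgd.analyticAt (isOpen_ne.mem_nhds (fun h ↦ by rw [h] at hw; linarith))
  -- the real part `a` is not an even integer `≤ -2`
  have hnot : ∀ n : ℕ, a ≠ -2 * ((n : ℝ) + 1) := by
    intro n h
    have h2 : (4 : ℝ) * ((n : ℝ) + 1 - K) = 1 := by rw [ha] at h; linarith
    have h3 : (4 * ((n : ℤ) + 1 - K) : ℤ) = 1 := by exact_mod_cast h2
    omega
  have key := Literature.Analysis.Complex.integral_boundary_rect_logDeriv_mul (f := riemannZeta)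
    (g := g) hab hcd
    (fun z hz ↦ analyticOn_riemannZeta z (by
      have hre : z.re ∈ Icc a (-(1 / 2)) := hz.1
      intro h; rw [h] at hre; simp at hre; linarith [hre.2]))
    (fun z hz ↦ hga z (by have hre : z.re ∈ Icc a (-(1 / 2)) := hz.1; exact hre.2))
    (fun t ht ↦ PsiOneExplicit.riemannZeta_ne_zero_of_re_nonpos (by simp; linarith [ht.2])
      fun n h ↦ by have := congrArg Complex.im h; simp at this; linarith)
    (fun t ht ↦ PsiOneExplicit.riemannZeta_ne_zero_of_re_nonpos (by simp; linarith [ht.2])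
      fun n h ↦ by have := congrArg Complex.im h; simp at this; linarith)
    (fun y _ ↦ PsiOneExplicit.riemannZeta_ne_zero_of_re_nonpos (by simp; rw [ha]; linarith)
      fun n h ↦ hnot n (by have := congrArg Complex.re h; simpa using this))
    (fun y _ ↦ PsiOneExplicit.riemannZeta_ne_zero_of_re_nonpos (by simp) fun n h ↦ by
      have := congrArg Complex.re h; simp at this
      linarith [(n.cast_nonneg : (0 : ℝ) ≤ n)])
  rw [hfun, Literature.Analysis.Complex.rectBoundaryIntegral, key]
  congr 1
  -- the zero set is `{-2(k+1) : k < K}`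
  have hT0 : 0 < T := by linarith
  have hset : {ρ : ℂ | riemannZeta ρ = 0 ∧ ρ ∈ Ioo a (-(1 / 2)) ×ℂ Ioo (-T) T} =
      (fun k : ℕ ↦ (-2 * ((k : ℂ) + 1))) '' ((Finset.range K : Finset ℕ) : Set ℕ) := by
    ext ρ
    simp only [mem_setOf_eq, Complex.mem_reProdIm, mem_Ioo, mem_image, Finset.coe_range, mem_Iio]
    constructor
    · rintro ⟨h0, ⟨h1, h2⟩, -, -⟩
      obtain ⟨n, hn⟩ := (riemannZeta_eq_zero_iff_of_re_nonpos (by linarith)).1 h0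
      refine ⟨n, ?_, hn.symm⟩
      have := congrArg Complex.re hn
      simp at this
      rw [this, ha] at h1
      have h' : n + 1 ≤ K := by
        by_contra hc
        push Not at hc
        have : (K : ℝ) + 1 ≤ (n : ℝ) + 1 := by exact_mod_cast hc
        linarith
      omega
    · rintro ⟨n, hn, rfl⟩
      have hnK : (n : ℝ) + 1 ≤ K := by exact_mod_cast hn
      refine ⟨riemannZeta_neg_two_mul_nat_add_one n, ⟨?_, ?_⟩, ?_, ?_⟩
      · simp; rw [ha]; linarith
      · simp; linarith [(n.cast_nonneg : (0 : ℝ) ≤ n)]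
      · simp; linarith
      · simp; linarith
  rw [hset, finsum_mem_image (fun m _ n _ h ↦ by
      have := congrArg Complex.re h; simp at this; exact_mod_cast this),
    finsum_mem_coe_finset]
  rfl

/-! ## The far-left line: integrability, and the passage `T → ∞` -/

/-- The line integral on the far-left line,
`J_K(s) = (1/2π) ∫_ℝ G(−2K − 1/2 + iy) dy = (1/2πi)∫_{(−2K−1/2)} (−ζ'/ζ)(w) F₀(s−w) dw`.
[cite: MontgomeryVaughan2007, §12.1.1 Exercise 6] -/
def farLeftJ (f : ℝ → ℝ) (s : ℂ) (K : ℕ) : ℂ :=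
  (1 / (2 * π) : ℂ) * ∫ y : ℝ, smoothedEFIntegrand f s ((((-(2 * (K : ℝ)) - 1 / 2 : ℝ)) : ℂ) + y * I)

variable {f p p' p'' : ℝ → ℝ} {x₀ : ℝ} {s : ℂ}

/-- The integrand is continuous at the points of `Re w ≤ −1/2` that are neither trivial zeros
nor `s`. [folklore] -/
theorem continuousAt_smoothedEFIntegrand (hfc : Continuous f) (hx₀ : 0 ≤ x₀)
    (hf0 : ∀ u, x₀ ≤ u → f u = 0) {w : ℂ} (hw1 : w ≠ 1) (hζ : riemannZeta w ≠ 0) (hsw : w ≠ s) :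
    ContinuousAt (smoothedEFIntegrand f s) w := by
  have han := analyticAt_riemannZeta' hw1
  have hF : DifferentiableAt ℂ (fun w ↦ fordLaplace₀ f (s - w)) w :=
    (differentiableAt_fordLaplace₀ hfc hx₀ hf0 (sub_ne_zero.2 (Ne.symm hsw))).comp w
      ((differentiableAt_const _).sub differentiableAt_id)
  exact ((han.deriv.continuousAt.div han.continuousAt hζ).neg).mul hF.continuousAt

/-- Points of `Re w ≤ −1/2` with `Im w ≠ 0`, or with `Re w ∈ {−2K−1/2, −1/2}`, are admissible.
[folklore] -/
theorem continuousAt_smoothedEFIntegrand_of (hfc : Continuous f) (hx₀ : 0 ≤ x₀)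
    (hf0 : ∀ u, x₀ ≤ u → f u = 0) (hσ₁ : -(1 / 2) < s.re) {K : ℕ} {w : ℂ} (hre : w.re ≤ -(1 / 2))
    (hw : w.im ≠ 0 ∨ (w.re = -(2 * (K : ℝ)) - 1 / 2 ∨ w.re = -(1 / 2))) :
    ContinuousAt (smoothedEFIntegrand f s) w := by
  have hw1 : w ≠ 1 := fun h ↦ by rw [h] at hre; simp at hre; linarith
  have hsw : w ≠ s := fun h ↦ by rw [h] at hre; linarith
  refine continuousAt_smoothedEFIntegrand hfc hx₀ hf0 hw1 ?_ hsw
  refine PsiOneExplicit.riemannZeta_ne_zero_of_re_nonpos (by linarith) fun n h ↦ ?_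
  rcases hw with hw | hw | hw
  · exact hw (by rw [h]; simp)
  · have := congrArg Complex.re h
    rw [hw] at this; simp at this
    have h2 : (4 : ℝ) * ((n : ℝ) + 1 - K) = 1 := by linarith
    have h3 : (4 * ((n : ℤ) + 1 - K) : ℤ) = 1 := by exact_mod_cast h2
    omega
  · have := congrArg Complex.re h
    rw [hw] at this; simp at this
    linarith [(n.cast_nonneg : (0 : ℝ) ≤ n)]

/-- **The far-left integrand is integrable on `ℝ`** (`K ≥ 1`, `−1/2 < Re s`):
`|ζ'/ζ| ≤ C + 6K + 16 + 2 log(1+|y|)` on the line (the tree's linear-in-`K` bound suffices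
here) against `|F₀(s − w)| ≤ D/((Re s + 2K + 1/2)² + (Im s − y)²)`. [folklore] -/
theorem integrable_integrand_farLeft (h : IsSmoothedEFTest f p p' p'' x₀) (hσ₁ : -(1 / 2) < s.re)
    {K : ℕ} (hK : 1 ≤ K) :
    Integrable fun y : ℝ ↦
      smoothedEFIntegrand f s ((((-(2 * (K : ℝ)) - 1 / 2 : ℝ)) : ℂ) + y * I) := by
  obtain ⟨Cr, hCr0, hCr⟩ := ZetaZeroSum.exists_norm_logDeriv_riemannXi_le_of_re_ge
  have hK1 : (1 : ℝ) ≤ K := by exact_mod_cast hK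
  set D := decayConst p' p'' x₀ with hD
  have hD0 : 0 ≤ D := decayConst_nonneg h.x₀_nonneg
  set a : ℝ := -(2 * (K : ℝ)) - 1 / 2 with ha
  set A : ℝ := s.re - a with hA
  have hA0 : 0 < A := by rw [hA, ha]; linarith
  have hC0 : 0 ≤ Cr + 6 * K + 16 := by positivity
  refine (((integrable_left_majorant' hC0 hA0 (t := s.im)).const_mul D)).mono' ?_
    (ae_of_all _ fun y ↦ ?_)
  · refine (continuous_iff_continuousAt.2 fun y ↦ ?_).aestronglyMeasurable
    have hc : ContinuousAt (smoothedEFIntegrand f s) (((a : ℝ) : ℂ) + y * I) :=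
      continuousAt_smoothedEFIntegrand_of h.cont h.x₀_nonneg h.eq_zero hσ₁ (K := K)
        (by simp; rw [ha]; linarith) (Or.inr (Or.inl (by simp [ha])))
    exact hc.comp (f := fun y : ℝ ↦ ((a : ℝ) : ℂ) + y * I) (Continuous.continuousAt (by fun_prop))
  set w : ℂ := ((a : ℝ) : ℂ) + y * I with hw
  have hsw_re : (s - w).re = A := by simp [hw, hA]
  have hsw_im : (s - w).im = s.im - y := by simp [hw]
  have hsw : s - w ≠ 0 := fun h ↦ by
    have := congrArg Complex.re h
    rw [hsw_re, Complex.zero_re] at this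
    linarith
  have hnorm : ‖s - w‖ ^ 2 = A ^ 2 + (s.im - y) ^ 2 := by
    rw [Complex.sq_norm, Complex.normSq_apply, hsw_re, hsw_im]; ring
  have hF : ‖fordLaplace₀ f (s - w)‖ ≤ D / (A ^ 2 + (s.im - y) ^ 2) := by
    rw [← hnorm]
    exact norm_fordLaplace₀_le h hsw (by rw [hsw_re]; linarith)
  have hz := PsiOneExplicit.norm_logDeriv_riemannZeta_farLeft_le hCr hK y
  rw [← ha, ← hw] at hz
  rw [smoothedEFIntegrand, norm_mul, norm_neg]
  have hC1 : 0 ≤ Cr + 6 * K + 16 + 2 * Real.log (1 + |y|) :=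
    add_nonneg hC0 (mul_nonneg two_pos.le (Real.log_nonneg (by linarith [abs_nonneg y])))
  calc ‖deriv riemannZeta w / riemannZeta w‖ * ‖fordLaplace₀ f (s - w)‖
      ≤ (Cr + 6 * K + 16 + 2 * Real.log (1 + |y|)) * (D / (A ^ 2 + (s.im - y) ^ 2)) :=
        mul_le_mul hz hF (norm_nonneg _) hC1
    _ = D * ((Cr + 6 * K + 16 + 2 * Real.log (1 + |y|)) / (A ^ 2 + (s.im - y) ^ 2)) := by ring

/-- **`J(s) = J_K(s) − Σ_{k<K} m(−2(k+1)) F₀(s + 2(k+1))`** (`K ≥ 1`, `−1/2 < Re s`): the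
contour identity in `Re w ≤ −1/2` with `T → ∞` (horizontal sides `O_K(log T/(T − |Im s|)²)`).
[cite: Ford2002Millennium, Lemma 4.5 (proof)] [cite: MontgomeryVaughan2007, §12.1.1 Exercise 6] -/
theorem smoothedEFRemainder_eq_farLeftJ_sub_sum (h : IsSmoothedEFTest f p p' p'' x₀)
    (hσ₁ : -(1 / 2) < s.re) {K : ℕ} (hK : 1 ≤ K) :
    smoothedEFRemainder f s = farLeftJ f s K -
      ∑ k ∈ Finset.range K, (riemannZetaZeroOrder (-2 * ((k : ℂ) + 1)) : ℂ) *
        fordLaplace₀ f (s + 2 * ((k : ℂ) + 1)) := by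
  have hK1 : (1 : ℝ) ≤ K := by exact_mod_cast hK
  obtain ⟨Cr, hCr0, hCr⟩ := ZetaZeroSum.exists_norm_logDeriv_riemannXi_le_of_re_ge
  set D := decayConst p' p'' x₀ with hD
  have hD0 : 0 ≤ D := decayConst_nonneg h.x₀_nonneg
  set a : ℝ := -(2 * (K : ℝ)) - 1 / 2 with ha
  set V : ℂ := ∑ k ∈ Finset.range K,
      (riemannZetaZeroOrder (-2 * ((k : ℂ) + 1)) : ℂ) * -fordLaplace₀ f (s - -2 * ((k : ℂ) + 1))
    with hV
  -- the boundary integral is constant in `T ≥ 1`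
  have hid : ∀ᶠ N : ℕ in atTop,
      Literature.Analysis.Complex.rectBoundaryIntegral (smoothedEFIntegrand f s) a (-(1 / 2)) (-(N : ℝ)) N =
        2 * π * I * V := by
    filter_upwards [eventually_ge_atTop 1] with N hN
    exact contour_identity_farLeft h.cont h.x₀_nonneg h.eq_zero hσ₁ hK (by exact_mod_cast hN)
  -- a threshold beyond which `2|Im s| + 2 ≤ N`
  obtain ⟨N₀, hN₀⟩ := exists_nat_gt (2 * |s.im| + 2)
  -- horizontal sides tend to `0`
  have hhor : ∀ sgn : ℝ, (sgn = 1 ∨ sgn = -1) →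
      Tendsto (fun N : ℕ ↦ ∫ σ : ℝ in a..(-(1 / 2)),
        smoothedEFIntegrand f s (σ + ((sgn * N : ℝ) : ℂ) * I)) atTop (𝓝 0) := by
    intro sgn hsgn
    have hmaj : Tendsto (fun N : ℕ ↦ (Cr + 2 * Real.log (2 * K + 3 + N) + K + 8) *
        (4 * D / (N : ℝ) ^ 2) * (2 * K)) atTop (𝓝 0) := by
      have h1 : Tendsto (fun N : ℕ ↦ Real.log (2 * K + 3 + (N : ℝ)) / (N : ℝ) ^ 2) atTop (𝓝 0) := by
        have hl := Real.tendsto_pow_log_div_mul_add_atTop 1 (-(2 * (K : ℝ) + 3)) 1 one_ne_zero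
        have h2 : Tendsto (fun N : ℕ ↦ 2 * (K : ℝ) + 3 + N) atTop atTop :=
          tendsto_atTop_add_const_left _ _ tendsto_natCast_atTop_atTop
        have h3 := hl.comp h2
        have h4 : Tendsto (fun N : ℕ ↦ ((N : ℝ))⁻¹) atTop (𝓝 0) :=
          tendsto_inv_atTop_zero.comp tendsto_natCast_atTop_atTop
        have := h3.mul h4
        simp only [mul_zero] at this
        refine this.congr' ?_
        filter_upwards [eventually_ge_atTop 1] with N hN
        have hN0 : (N : ℝ) ≠ 0 := by positivity
        simp only [Function.comp_apply, pow_one, one_mul]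
        rw [show (2 * (K : ℝ) + 3 + (N : ℝ) + -(2 * (K : ℝ) + 3)) = (N : ℝ) by ring, sq]
        field_simp
      have h2 : Tendsto (fun N : ℕ ↦ ((N : ℝ) ^ 2)⁻¹) atTop (𝓝 0) := by
        have := ((tendsto_inv_atTop_zero (𝕜 := ℝ)).comp
          (tendsto_natCast_atTop_atTop (R := ℝ))).pow 2
        simpa [inv_pow] using this
      have : Tendsto (fun N : ℕ ↦ (2 * (Real.log (2 * K + 3 + (N : ℝ)) / (N : ℝ) ^ 2) +
          (Cr + K + 8) * ((N : ℝ) ^ 2)⁻¹) * (4 * D * (2 * K))) atTop (𝓝 0) := by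
        simpa using ((h1.const_mul 2).add (h2.const_mul (Cr + K + 8))).mul_const
          (4 * D * (2 * K))
      refine this.congr fun N ↦ ?_
      field_simp
      ring
    refine squeeze_zero_norm' ?_ hmaj
    filter_upwards [eventually_ge_atTop (max N₀ 2)] with N hN
    have hN2 : (2 : ℝ) ≤ N := by exact_mod_cast le_of_max_le_right hN
    have hNN₀ : (N₀ : ℝ) ≤ N := by exact_mod_cast le_of_max_le_left hN
    have hNs : (N : ℝ) / 2 ≤ N - |s.im| := by linarith
    have hN0 : (0 : ℝ) < N := by linarith
    have ht : |sgn * (N : ℝ)| = N := by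
      rcases hsgn with rfl | rfl <;> simp [abs_of_nonneg (by linarith : (0 : ℝ) ≤ N)]
    have hint := intervalIntegral.norm_integral_le_of_norm_le_const (a := a) (b := -(1 / 2))
      (C := (Cr + 2 * Real.log (2 * K + 3 + N) + K + 8) * (4 * D / (N : ℝ) ^ 2))
      (f := fun σ : ℝ ↦ smoothedEFIntegrand f s (σ + ((sgn * N : ℝ) : ℂ) * I)) ?_
    · rw [show |(-(1 / 2) : ℝ) - a| = 2 * K by
        rw [ha, abs_of_pos (by linarith)]; ring] at hint
      exact hint
    intro σ hσ
    rw [uIoc_of_le (by rw [ha]; linarith)] at hσ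
    have hz := PsiOneExplicit.norm_logDeriv_riemannZeta_le_of_re_le hCr (K := K) (σ := σ) (t := sgn * N)
      (by rw [ha] at hσ; exact hσ.1.le) hσ.2 (by rw [ht]; exact hN2)
    rw [ht] at hz
    have hC0 : 0 ≤ Cr + 2 * Real.log (2 * K + 3 + N) + K + 8 := (norm_nonneg _).trans hz
    set w : ℂ := (σ : ℂ) + ((sgn * N : ℝ) : ℂ) * I with hw
    rw [smoothedEFIntegrand, norm_mul, norm_neg]
    refine mul_le_mul hz ?_ (by positivity) hC0
    -- `‖F₀(s − w)‖ ≤ D/‖s − w‖² ≤ D/(N − |Im s|)² ≤ 4D/N²`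
    have hsw_re : (s - w).re = s.re - σ := by simp [hw]
    have hsw_im : (s - w).im = s.im - sgn * N := by simp [hw]
    have him : (N : ℝ) - |s.im| ≤ |(s - w).im| := by
      rw [hsw_im]
      have h1 : |sgn * (N : ℝ)| - |s.im| ≤ |s.im - sgn * N| := by
        have := abs_sub_abs_le_abs_sub (sgn * (N : ℝ)) s.im
        rwa [abs_sub_comm] at this
      rwa [ht] at h1
    have hnsw : (N : ℝ) / 2 ≤ ‖s - w‖ := (hNs.trans him).trans (Complex.abs_im_le_norm _)
    have hsw : s - w ≠ 0 := fun h0 ↦ by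
      rw [h0, norm_zero] at hnsw; linarith
    have hF := norm_fordLaplace₀_le h hsw (by rw [hsw_re]; linarith [hσ.2])
    refine hF.trans ?_
    rw [div_le_div_iff₀ (by positivity) (by positivity)]
    have : (N : ℝ) ^ 2 ≤ 4 * ‖s - w‖ ^ 2 := by nlinarith [norm_nonneg (s - w)]
    nlinarith
  -- vertical sides
  have hNtop : Tendsto (fun N : ℕ ↦ (N : ℝ)) atTop atTop := tendsto_natCast_atTop_atTop
  have hright : Tendsto (fun N : ℕ ↦ ∫ y : ℝ in (-(N : ℝ))..N,
      smoothedEFIntegrand f s (((-(1 / 2) : ℝ) : ℂ) + y * I)) atTop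
      (𝓝 (2 * π * smoothedEFRemainder f s)) := by
    have h' := intervalIntegral_tendsto_integral (integrable_integrand_left h hσ₁)
      (tendsto_neg_atTop_atBot.comp hNtop) hNtop
    have hval : ∫ t : ℝ, smoothedEFIntegrand f s (((-(1 / 2) : ℝ) : ℂ) + t * I) =
        2 * π * smoothedEFRemainder f s := by
      have hπ : (2 * π : ℂ) ≠ 0 := by simp [Real.pi_ne_zero]
      rw [smoothedEFRemainder, ← mul_assoc, mul_one_div_cancel hπ, one_mul]
    rw [hval] at h'
    exact h'
  have hleft : Tendsto (fun N : ℕ ↦ ∫ y : ℝ in (-(N : ℝ))..N,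
      smoothedEFIntegrand f s (((a : ℝ) : ℂ) + y * I)) atTop (𝓝 (2 * π * farLeftJ f s K)) := by
    have h' := intervalIntegral_tendsto_integral (integrable_integrand_farLeft h hσ₁ hK)
      (tendsto_neg_atTop_atBot.comp hNtop) hNtop
    have hval : ∫ t : ℝ, smoothedEFIntegrand f s ((((-(2 * (K : ℝ)) - 1 / 2 : ℝ)) : ℂ) + t * I) =
        2 * π * farLeftJ f s K := by
      have hπ : (2 * π : ℂ) ≠ 0 := by simp [Real.pi_ne_zero]
      rw [farLeftJ, ← mul_assoc, mul_one_div_cancel hπ, one_mul]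
    rw [hval] at h'
    exact h'
  have hlim1 : Tendsto (fun N : ℕ ↦
      Literature.Analysis.Complex.rectBoundaryIntegral (smoothedEFIntegrand f s) a (-(1 / 2)) (-(N : ℝ)) N)
      atTop (𝓝 (0 - 0 + I * (2 * π * smoothedEFRemainder f s) - I * (2 * π * farLeftJ f s K))) := by
    have hb := hhor (-1) (Or.inr rfl)
    have ht := hhor 1 (Or.inl rfl)
    simp only [neg_mul, one_mul] at hb ht
    have := ((hb.sub ht).add (hright.const_mul I)).sub (hleft.const_mul I)
    refine this.congr fun N ↦ ?_
    simp only [Literature.Analysis.Complex.rectBoundaryIntegral]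
  have heq := tendsto_nhds_unique (tendsto_const_nhds.congr' (hid.mono fun N h ↦ h.symm)) hlim1
  have hπ : (2 * π * I : ℂ) ≠ 0 := by simp [Real.pi_ne_zero]
  have key : 2 * π * I * V = 2 * π * I * (smoothedEFRemainder f s - farLeftJ f s K) := by
    rw [heq]; ring
  have hVeq := mul_left_cancel₀ hπ key
  have hV' : V = -∑ k ∈ Finset.range K, (riemannZetaZeroOrder (-2 * ((k : ℂ) + 1)) : ℂ) *
      fordLaplace₀ f (s + 2 * ((k : ℂ) + 1)) := by
    rw [hV, ← Finset.sum_neg_distrib]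
    refine Finset.sum_congr rfl fun k _ ↦ ?_
    rw [show s - -2 * ((k : ℂ) + 1) = s + 2 * ((k : ℂ) + 1) by ring]
    ring
  rw [hV'] at hVeq
  linear_combination -hVeq

/-! ## The far-left integrals tend to `0` -/

/-- `(A + 2 log(1+|u|))/(1 + u²)` is integrable (`A ≥ 0`). [folklore] -/
theorem integrable_log_majorant_one {A : ℝ} (hA : 0 ≤ A) :
    Integrable fun u : ℝ ↦ (A + 2 * Real.log (1 + |u|)) / (1 + u ^ 2) := by
  refine (PsiOneExplicit.integrable_left_majorant hA).mono' ?_ (ae_of_all _ fun u ↦ ?_)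
  · refine Continuous.aestronglyMeasurable ?_
    refine Continuous.div (continuous_const.add (continuous_const.mul
      ((continuous_const.add continuous_abs).log fun u ↦
        (by positivity : (0 : ℝ) < 1 + |u|).ne'))) (by fun_prop)
      fun u ↦ (by positivity : (1 + u ^ 2 : ℝ) ≠ 0)
  have hlog : 0 ≤ Real.log (1 + |u|) := Real.log_nonneg (by linarith [abs_nonneg u])
  rw [Real.norm_eq_abs, abs_of_nonneg (by positivity)]
  exact div_le_div_of_nonneg_left (by positivity) (by positivity) (by linarith)

/-- **Scaling bound**: for `X ≥ 1`, `β ≥ 0`,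
`∫ (β + 2 log(1+|v|))/(X² + v²) dv ≤ (π(β + 2 log X) + 2 I₁)/X`,
`I₁ = ∫ log(1+|u|)/(1+u²) du` (substitute `v = Xu`, `1 + |v| ≤ X(1 + |u|)`). [folklore] -/
theorem integral_log_majorant_le {X β : ℝ} (hX : 1 ≤ X) (hβ : 0 ≤ β) :
    ∫ v : ℝ, (β + 2 * Real.log (1 + |v|)) / (X ^ 2 + v ^ 2) ≤
      (π * (β + 2 * Real.log X) + 2 * ∫ u : ℝ, Real.log (1 + |u|) / (1 + u ^ 2)) / X := by
  have hX0 : 0 < X := by linarith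
  have hlogX : 0 ≤ Real.log X := Real.log_nonneg hX
  set β' : ℝ := β + 2 * Real.log X with hβ'
  have hβ'0 : 0 ≤ β' := by positivity
  set hh : ℝ → ℝ := fun u ↦ (β' + 2 * Real.log (1 + |u|)) / (1 + u ^ 2) with hhh
  have hhint : Integrable hh := integrable_log_majorant_one hβ'0
  -- pointwise: `(β + 2 log(1+|v|))/(X² + v²) ≤ hh(v/X)/X²`
  have hpt : ∀ v : ℝ, (β + 2 * Real.log (1 + |v|)) / (X ^ 2 + v ^ 2) ≤ hh (v / X) / X ^ 2 := by
    intro v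
    have hlog : Real.log (1 + |v|) ≤ Real.log X + Real.log (1 + |v / X|) := by
      rw [← Real.log_mul hX0.ne' (by positivity)]
      refine Real.log_le_log (by positivity) ?_
      rw [abs_div, abs_of_pos hX0, mul_add, mul_one, mul_div_cancel₀ _ hX0.ne']
      linarith
    have heq : hh (v / X) / X ^ 2 = (β' + 2 * Real.log (1 + |v / X|)) / (X ^ 2 + v ^ 2) := by
      simp only [hhh]
      field_simp
    rw [heq]
    refine div_le_div_of_nonneg_right ?_ (by positivity)
    rw [hβ']; linarith
  have hlhs : Integrable fun v : ℝ ↦ (β + 2 * Real.log (1 + |v|)) / (X ^ 2 + v ^ 2) := by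
    have := integrable_left_majorant' hβ hX0 (t := 0)
    refine this.congr (ae_of_all _ fun v ↦ ?_)
    simp
  have hrhs : Integrable fun v : ℝ ↦ hh (v / X) / X ^ 2 := (hhint.comp_div hX0.ne').div_const _
  calc ∫ v : ℝ, (β + 2 * Real.log (1 + |v|)) / (X ^ 2 + v ^ 2)
      ≤ ∫ v : ℝ, hh (v / X) / X ^ 2 := integral_mono hlhs hrhs hpt
    _ = (∫ v : ℝ, hh (v / X)) / X ^ 2 := by
        rw [show (fun v : ℝ ↦ hh (v / X) / X ^ 2) = fun v ↦ (X ^ 2)⁻¹ * hh (v / X) by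
          funext v; ring, MeasureTheory.integral_const_mul]; ring
    _ = X * (∫ u : ℝ, hh u) / X ^ 2 := by
        rw [Measure.integral_comp_div hh X, smul_eq_mul, abs_of_pos hX0]
    _ = (∫ u : ℝ, hh u) / X := by field_simp
    _ = (π * β' + 2 * ∫ u : ℝ, Real.log (1 + |u|) / (1 + u ^ 2)) / X := by
        congr 1
        have h1 : Integrable fun u : ℝ ↦ β' * (1 + u ^ 2)⁻¹ :=
          (integrable_inv_one_add_sq).const_mul β'
        have h2 : Integrable fun u : ℝ ↦ 2 * (Real.log (1 + |u|) / (1 + u ^ 2)) := by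
          have := integrable_log_majorant_one le_rfl
          simp only [zero_add] at this
          refine (this.congr (ae_of_all _ fun u ↦ ?_))
          ring
        have hsplit : hh = fun u ↦ β' * (1 + u ^ 2)⁻¹ + 2 * (Real.log (1 + |u|) / (1 + u ^ 2)) := by
          funext u; simp only [hhh]; ring
        rw [hsplit, integral_add h1 h2, MeasureTheory.integral_const_mul, MeasureTheory.integral_const_mul,
          integral_univ_inv_one_add_sq]
        ring

/-- **`J_K(s) → 0` as `K → ∞`** (`−1/2 < Re s`): with `X_K = Re s + 2K + 1/2 ≥ 2K`,
`‖J_K(s)‖ ≤ (D/2π)(π(C + 2 log(K+1) + 2 log(1+|Im s|) + 2 log X_K) + 2I₁)/X_K = O(K^{-1/2})`.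
[cite: MontgomeryVaughan2007, §12.1.1 Exercise 6] -/
theorem tendsto_farLeftJ (h : IsSmoothedEFTest f p p' p'' x₀) (hσ₁ : -(1 / 2) < s.re) :
    Tendsto (fun K : ℕ ↦ farLeftJ f s K) atTop (𝓝 0) := by
  obtain ⟨C, hC0, hC⟩ := exists_norm_logDeriv_riemannZeta_farLeft_le_log
  set D := decayConst p' p'' x₀ with hD
  have hD0 : 0 ≤ D := decayConst_nonneg h.x₀_nonneg
  set I₁ : ℝ := ∫ u : ℝ, Real.log (1 + |u|) / (1 + u ^ 2) with hI₁
  have hI₁0 : 0 ≤ I₁ := integral_nonneg fun u ↦ div_nonneg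
    (Real.log_nonneg (by linarith [abs_nonneg u])) (by positivity)
  set t : ℝ := s.im with ht
  set Lt : ℝ := Real.log (1 + |t|) with hLt
  have hLt0 : 0 ≤ Lt := Real.log_nonneg (by linarith [abs_nonneg t])
  set A₁ : ℝ := (π * (C + 2 * Lt) + 2 * I₁) / 2 with hA₁
  have hA₁0 : 0 ≤ A₁ := by positivity
  -- the bound for `K ≥ 1`
  have hbound : ∀ K : ℕ, 1 ≤ K → ‖farLeftJ f s K‖ ≤
      D / (2 * π) * (A₁ * (1 / K) + π * (Real.log ((K : ℝ) + 1) / K) +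
        4 * π * (1 / Real.sqrt (2 * K))) := by
    intro K hK
    have hK1 : (1 : ℝ) ≤ K := by exact_mod_cast hK
    have hK0 : (0 : ℝ) < K := by linarith
    set a : ℝ := -(2 * (K : ℝ)) - 1 / 2 with ha
    set X : ℝ := s.re - a with hX
    have hX2 : 2 * (K : ℝ) ≤ X := by rw [hX, ha]; linarith
    have hX1 : 1 ≤ X := by linarith
    have hX0 : 0 < X := by linarith
    set LK : ℝ := Real.log ((K : ℝ) + 1) with hLK
    have hLK0 : 0 ≤ LK := Real.log_nonneg (by linarith)
    set β : ℝ := C + 2 * LK + 2 * Lt with hβ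
    have hβ0 : 0 ≤ β := by positivity
    set m : ℝ → ℝ := fun v ↦ (β + 2 * Real.log (1 + |v|)) / (X ^ 2 + v ^ 2) with hm
    -- pointwise majorant on the line
    have hpt : ∀ y : ℝ, ‖smoothedEFIntegrand f s ((((-(2 * (K : ℝ)) - 1 / 2 : ℝ)) : ℂ) + y * I)‖ ≤
        D * m (y - t) := by
      intro y
      set w : ℂ := ((((-(2 * (K : ℝ)) - 1 / 2 : ℝ)) : ℂ) + y * I) with hw
      have hsw_re : (s - w).re = X := by simp [hw, hX, ha]
      have hsw_im : (s - w).im = t - y := by simp [hw, ht]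
      have hsw : s - w ≠ 0 := fun h0 ↦ by
        have := congrArg Complex.re h0
        rw [hsw_re, Complex.zero_re] at this
        linarith
      have hnorm : ‖s - w‖ ^ 2 = X ^ 2 + (y - t) ^ 2 := by
        rw [Complex.sq_norm, Complex.normSq_apply, hsw_re, hsw_im]; ring
      have hF : ‖fordLaplace₀ f (s - w)‖ ≤ D / (X ^ 2 + (y - t) ^ 2) := by
        rw [← hnorm]
        exact norm_fordLaplace₀_le h hsw (by rw [hsw_re]; linarith)
      have hz := hC K hK y
      rw [← hw] at hz
      have hlog := log_one_add_abs_le_add y t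
      have hnum : C + 2 * LK + 2 * Real.log (1 + |y|) ≤ β + 2 * Real.log (1 + |y - t|) := by
        rw [hβ]; linarith
      have hnum0 : 0 ≤ C + 2 * LK + 2 * Real.log (1 + |y|) := (norm_nonneg _).trans hz
      rw [smoothedEFIntegrand, norm_mul, norm_neg]
      calc ‖deriv riemannZeta w / riemannZeta w‖ * ‖fordLaplace₀ f (s - w)‖
          ≤ (C + 2 * LK + 2 * Real.log (1 + |y|)) * (D / (X ^ 2 + (y - t) ^ 2)) :=
            mul_le_mul hz hF (norm_nonneg _) hnum0
        _ ≤ (β + 2 * Real.log (1 + |y - t|)) * (D / (X ^ 2 + (y - t) ^ 2)) :=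
            mul_le_mul_of_nonneg_right hnum (by positivity)
        _ = D * m (y - t) := by simp only [hm]; ring
    have hmint : Integrable m := by
      have := integrable_left_majorant' hβ0 hX0 (t := 0)
      refine this.congr (ae_of_all _ fun v ↦ ?_)
      simp [hm]
    have hmint' : Integrable fun y : ℝ ↦ D * m (y - t) := (hmint.comp_sub_right t).const_mul D
    -- integrate
    have hI : ‖∫ y : ℝ, smoothedEFIntegrand f s ((((-(2 * (K : ℝ)) - 1 / 2 : ℝ)) : ℂ) + y * I)‖ ≤
        D * ((π * (β + 2 * Real.log X) + 2 * I₁) / X) := by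
      calc ‖∫ y : ℝ, smoothedEFIntegrand f s ((((-(2 * (K : ℝ)) - 1 / 2 : ℝ)) : ℂ) + y * I)‖
          ≤ ∫ y : ℝ, D * m (y - t) :=
            (MeasureTheory.norm_integral_le_integral_norm _).trans (integral_mono_of_nonneg
              (ae_of_all _ fun y ↦ norm_nonneg _) hmint' (ae_of_all _ hpt))
        _ = D * ∫ v : ℝ, m v := by
            rw [MeasureTheory.integral_const_mul]
            congr 1
            exact integral_sub_right_eq_self m t
        _ ≤ D * ((π * (β + 2 * Real.log X) + 2 * I₁) / X) :=
            mul_le_mul_of_nonneg_left (integral_log_majorant_le hX1 hβ0) hD0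
    -- `log X ≤ 2 √X`, `1/X ≤ 1/(2K)`, `1/√X ≤ 1/√(2K)`
    have hsqrtX : 0 < Real.sqrt X := Real.sqrt_pos.2 hX0
    have hlogX : Real.log X ≤ 2 * Real.sqrt X := by
      have := Real.log_le_rpow_div hX0.le (by norm_num : (0 : ℝ) < 1 / 2)
      rw [← Real.sqrt_eq_rpow] at this
      linarith
    have hlogX0 : 0 ≤ Real.log X := Real.log_nonneg hX1
    have hsq : 1 / Real.sqrt X ≤ 1 / Real.sqrt (2 * K) :=
      one_div_le_one_div_of_le (Real.sqrt_pos.2 (by linarith)) (Real.sqrt_le_sqrt hX2)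
    have hkey : (π * (β + 2 * Real.log X) + 2 * I₁) / X ≤
        A₁ * (1 / K) + π * (LK / K) + 4 * π * (1 / Real.sqrt (2 * K)) := by
      have e1 : (π * (β + 2 * Real.log X) + 2 * I₁) / X =
          (π * β + 2 * I₁) / X + 2 * π * (Real.log X / X) := by
        field_simp; ring
      rw [e1]
      have h1 : (π * β + 2 * I₁) / X ≤ (π * β + 2 * I₁) / (2 * K) :=
        div_le_div_of_nonneg_left (by positivity) (by positivity) hX2
      have h2 : Real.log X / X ≤ 2 * (1 / Real.sqrt X) := by
        rw [div_le_iff₀ hX0]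
        have hXX : Real.sqrt X * Real.sqrt X = X := Real.mul_self_sqrt hX0.le
        calc Real.log X ≤ 2 * Real.sqrt X := hlogX
          _ = 2 * (1 / Real.sqrt X) * X := by
              field_simp; nlinarith [hXX]
      have e2 : (π * β + 2 * I₁) / (2 * K) = A₁ * (1 / K) + π * (LK / K) := by
        rw [hβ, hA₁]; field_simp; ring
      nlinarith [Real.pi_pos, h1, h2, hsq, e2]
    -- assemble
    rw [farLeftJ, norm_mul]
    have hn : ‖(1 / (2 * π) : ℂ)‖ = 1 / (2 * π) := by
      rw [show (1 / (2 * π) : ℂ) = ((1 / (2 * π) : ℝ) : ℂ) by push_cast; ring, Complex.norm_real,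
        Real.norm_eq_abs, abs_of_pos (by positivity)]
    rw [hn]
    calc 1 / (2 * π) * ‖∫ y : ℝ, smoothedEFIntegrand f s ((((-(2 * (K : ℝ)) - 1 / 2 : ℝ)) : ℂ) + y * I)‖
        ≤ 1 / (2 * π) * (D * ((π * (β + 2 * Real.log X) + 2 * I₁) / X)) :=
          mul_le_mul_of_nonneg_left hI (by positivity)
      _ ≤ 1 / (2 * π) * (D * (A₁ * (1 / K) + π * (LK / K) +
            4 * π * (1 / Real.sqrt (2 * K)))) := by gcongr
      _ = D / (2 * π) * (A₁ * (1 / K) + π * (Real.log ((K : ℝ) + 1) / K) +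
            4 * π * (1 / Real.sqrt (2 * K))) := by
          rw [hLK]; ring
  -- the majorant tends to `0`
  have hlim : Tendsto (fun K : ℕ ↦ D / (2 * π) * (A₁ * (1 / K) + π * (Real.log ((K : ℝ) + 1) / K) +
      4 * π * (1 / Real.sqrt (2 * K)))) atTop (𝓝 0) := by
    have h1 : Tendsto (fun K : ℕ ↦ (1 : ℝ) / K) atTop (𝓝 0) := tendsto_one_div_atTop_nhds_zero_nat
    have h2 : Tendsto (fun K : ℕ ↦ Real.log ((K : ℝ) + 1) / K) atTop (𝓝 0) := by
      have hl := Real.tendsto_pow_log_div_mul_add_atTop 1 (-1) 1 one_ne_zero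
      have hc : Tendsto (fun K : ℕ ↦ (K : ℝ) + 1) atTop atTop :=
        tendsto_atTop_add_const_right _ _ tendsto_natCast_atTop_atTop
      have := hl.comp hc
      refine this.congr fun K ↦ ?_
      simp only [Function.comp_apply, pow_one, one_mul]
      ring_nf
    have h3 : Tendsto (fun K : ℕ ↦ 1 / Real.sqrt (2 * K)) atTop (𝓝 0) := by
      have hc : Tendsto (fun K : ℕ ↦ 2 * (K : ℝ)) atTop atTop :=
        tendsto_natCast_atTop_atTop.const_mul_atTop two_pos
      have hs := Real.tendsto_sqrt_atTop.comp hc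
      have := (tendsto_const_nhds (x := (1 : ℝ))).div_atTop hs
      exact this
    have := (((h1.const_mul A₁).add (h2.const_mul π)).add (h3.const_mul (4 * π))).const_mul
      (D / (2 * π))
    simpa using this
  refine squeeze_zero_norm' ?_ hlim
  filter_upwards [eventually_ge_atTop 1] with K hK using hbound K hK

/-! ## The remainder as the sum over the trivial zeros -/

/-- `‖s + 2(k+1)‖ ≥ 2(k+1) + Re s > 0` for `−1/2 < Re s`; in particular `s + 2(k+1) ≠ 0`.
[folklore] -/
theorem norm_add_two_mul_ge (s : ℂ) (k : ℕ) :
    2 * ((k : ℝ) + 1) + s.re ≤ ‖s + 2 * ((k : ℂ) + 1)‖ := by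
  have := Complex.re_le_norm (s + 2 * ((k : ℂ) + 1))
  simp at this
  linarith

/-- **The terms are absolutely summable**: `‖F₀(s + 2(k+1))‖ ≤ D/(2(k+1) + Re s)²`.
[folklore] -/
theorem summable_norm_fordLaplace₀_trivialZeros (h : IsSmoothedEFTest f p p' p'' x₀)
    (hσ₁ : -(1 / 2) < s.re) :
    Summable fun k : ℕ ↦ ‖fordLaplace₀ f (s + 2 * ((k : ℂ) + 1))‖ := by
  set D := decayConst p' p'' x₀ with hD
  have hD0 : 0 ≤ D := decayConst_nonneg h.x₀_nonneg
  have hk0 : ∀ k : ℕ, (0 : ℝ) ≤ k := fun k ↦ k.cast_nonneg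
  -- compare with `D / (k + 1)^2`
  have hdom : Summable fun k : ℕ ↦ D * (1 / ((k : ℝ) + 1) ^ 2) := by
    have := (summable_nat_add_iff 1).2 (Real.summable_one_div_nat_pow.2 one_lt_two)
    refine (this.mul_left D).congr fun k ↦ ?_
    push_cast; ring
  refine hdom.of_nonneg_of_le (fun _ ↦ norm_nonneg _) fun k ↦ ?_
  have hn := norm_add_two_mul_ge s k
  have hpos : 0 < 2 * ((k : ℝ) + 1) + s.re := by linarith [hk0 k]
  have hne : s + 2 * ((k : ℂ) + 1) ≠ 0 := fun h0 ↦ by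
    rw [h0, norm_zero] at hn; linarith
  have hb := norm_fordLaplace₀_le h hne (by simp; linarith [hk0 k])
  refine hb.trans ?_
  rw [mul_one_div]
  refine div_le_div_of_nonneg_left hD0 (by positivity) ?_
  have : (k : ℝ) + 1 ≤ ‖s + 2 * ((k : ℂ) + 1)‖ := by linarith [hk0 k]
  nlinarith [hk0 k]

/-- **`J(s) = −Σ_{k≥0} F₀(s + 2(k+1))`** — the remainder of the smoothed explicit formula is
the (absolutely convergent) sum over the trivial zeros of `ζ` (each simple):
`HasSum (k ↦ F₀(s + 2(k+1))) (−J(s))` for `−1/2 < Re s`.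
[cite: Ford2002Millennium, Lemma 4.5 (proof, (4.8))] [cite: MontgomeryVaughan2007, §12.1.1 Exercise 6] -/
theorem hasSum_smoothedEFRemainder_trivialZeros (h : IsSmoothedEFTest f p p' p'' x₀)
    (hσ₁ : -(1 / 2) < s.re) :
    HasSum (fun k : ℕ ↦ fordLaplace₀ f (s + 2 * ((k : ℂ) + 1))) (-smoothedEFRemainder f s) := by
  have hsumm : Summable fun k : ℕ ↦ fordLaplace₀ f (s + 2 * ((k : ℂ) + 1)) :=
    (summable_norm_fordLaplace₀_trivialZeros h hσ₁).of_norm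
  rw [hsumm.hasSum_iff_tendsto_nat]
  -- partial sums: `Σ_{k<K} = J_K − J` for `K ≥ 1`
  have hpart : ∀ᶠ K : ℕ in atTop, ∑ k ∈ Finset.range K, fordLaplace₀ f (s + 2 * ((k : ℂ) + 1)) =
      farLeftJ f s K - smoothedEFRemainder f s := by
    filter_upwards [eventually_ge_atTop 1] with K hK
    have h1 := smoothedEFRemainder_eq_farLeftJ_sub_sum h hσ₁ hK
    have h2 : ∑ k ∈ Finset.range K, (riemannZetaZeroOrder (-2 * ((k : ℂ) + 1)) : ℂ) *
        fordLaplace₀ f (s + 2 * ((k : ℂ) + 1)) =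
        ∑ k ∈ Finset.range K, fordLaplace₀ f (s + 2 * ((k : ℂ) + 1)) := by
      refine Finset.sum_congr rfl fun k _ ↦ ?_
      rw [riemannZetaZeroOrder_trivialZero k]; simp
    rw [h2] at h1
    linear_combination h1
  have hlim : Tendsto (fun K : ℕ ↦ farLeftJ f s K - smoothedEFRemainder f s) atTop
      (𝓝 (0 - smoothedEFRemainder f s)) := (tendsto_farLeftJ h hσ₁).sub tendsto_const_nhds
  rw [zero_sub] at hlim
  exact hlim.congr' (hpart.mono fun K hK ↦ hK.symm)

/-- **The smoothed explicit formula with the trivial zeros** (Ford 2002, Lemma 4.5, with the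
remainder evaluated; de la Vallée Poussin): for an admissible smoothing `f` and
`−1/2 < Re s < 3/2`, `s ≠ 1`, `ζ(s) ≠ 0`,
`K_f(s) = −f(0) ζ'/ζ(s) + F₀(s−1) − Σ_ρ m(ρ) F₀(s−ρ) − Σ_{k≥0} F₀(s + 2(k+1))`.
[cite: Ford2002Millennium, Lemma 4.5] [cite: MontgomeryVaughan2007, §12.1.1 Exercise 6] -/
theorem fordK_eq_explicit_trivialZeros (h : IsSmoothedEFTest f p p' p'' x₀)
    (hσ₁ : -(1 / 2) < s.re) (hσ₂ : s.re < 3 / 2) (hs1 : s ≠ 1) (hζs : riemannZeta s ≠ 0) :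
    fordK f s = -(f 0 : ℂ) * (deriv riemannZeta s / riemannZeta s) + fordLaplace₀ f (s - 1) -
      (∑' ρ : RHWave0.riemannZetaNontrivialZeros,
        (riemannZetaZeroOrder (ρ : ℂ) : ℂ) * fordLaplace₀ f (s - ρ)) -
      ∑' k : ℕ, fordLaplace₀ f (s + 2 * ((k : ℂ) + 1)) := by
  rw [fordK_eq_explicit h hσ₁ hσ₂ hs1 hζs, (hasSum_smoothedEFRemainder_trivialZeros h hσ₁).tsum_eq]
  ring

/-! ## The bound `|J(s)| ≤ D/4` on `Re s ≥ 1` from Ford's (4.5) -/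

/-- `Σ_{k≥0} 1/(2(k+1) + σ)² ≤ 1/4` for `σ ≥ 1`
(`1/(2k+3)² ≤ 1/((2k+2)(2k+4)) = ¼(1/(k+1) − 1/(k+2))`, telescoping). [folklore] -/
theorem sum_inv_sq_trivial_le {σ : ℝ} (hσ : 1 ≤ σ) (n : ℕ) :
    ∑ k ∈ Finset.range n, 1 / (2 * ((k : ℝ) + 1) + σ) ^ 2 ≤ 1 / 4 := by
  have hle : ∀ k ∈ Finset.range n, 1 / (2 * ((k : ℝ) + 1) + σ) ^ 2 ≤
      1 / 4 * (1 / ((k : ℝ) + 1) - 1 / ((k : ℝ) + 1 + 1)) := by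
    intro k _
    have hk : (0 : ℝ) ≤ k := k.cast_nonneg
    have h1 : 0 < (k : ℝ) + 1 := by linarith
    have h2 : 0 < (k : ℝ) + 1 + 1 := by linarith
    rw [div_sub_div _ _ h1.ne' h2.ne', ← mul_div_assoc, div_le_div_iff₀ (by positivity) (by positivity)]
    nlinarith [mul_nonneg (by linarith : (0 : ℝ) ≤ σ - 1) hk, sq_nonneg (σ - 1)]
  refine (Finset.sum_le_sum hle).trans ?_
  rw [← Finset.mul_sum]
  have htel : ∀ m : ℕ, ∑ k ∈ Finset.range m, (1 / ((k : ℝ) + 1) - 1 / ((k : ℝ) + 1 + 1)) =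
      1 - 1 / ((m : ℝ) + 1) := by
    intro m
    induction m with
    | zero => simp
    | succ m ih => rw [Finset.sum_range_succ, ih]; push_cast; ring
  rw [htel n]
  have : 0 ≤ 1 / ((n : ℝ) + 1) := by positivity
  linarith

/-- **`|J(s)| ≤ D/4` for `Re s ≥ 1`**, for every constant `D` with Ford's (4.5)
`|F₀(z)| ≤ D/|z|²` on `Re z ≥ 0`, `|z| ≥ η`, some `η ≤ 2` (as in `IsFordSmoothing f η D`;
`F₀ = fordLaplace₀ f = fordLaplace f − f(0)/z`): `|J(s)| ≤ Σ_k |F₀(s+2(k+1))| ≤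
D Σ_k 1/(2k+2+Re s)² ≤ D Σ_k 1/(2k+3)² ≤ D/4`. This replaces `|E| ≤ D(1.72 + ⅓ log(1 + Im s))`
in Ford's Lemma 4.5 (at `s = σ > 1` and `s = 1 + it`). [cite: Ford2002Millennium, Lemma 4.5] -/
theorem norm_smoothedEFRemainder_le (h : IsSmoothedEFTest f p p' p'' x₀) (hσ : 1 ≤ s.re)
    {D η : ℝ} (hη : η ≤ 2)
    (hD : ∀ z : ℂ, 0 ≤ z.re → η ≤ ‖z‖ → ‖fordLaplace₀ f z‖ ≤ D / ‖z‖ ^ 2) :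
    ‖smoothedEFRemainder f s‖ ≤ D / 4 := by
  have hσ₁ : -(1 / 2) < s.re := by linarith
  have hk0 : ∀ k : ℕ, (0 : ℝ) ≤ k := fun k ↦ k.cast_nonneg
  have hHS := hasSum_smoothedEFRemainder_trivialZeros h hσ₁
  have hsn := summable_norm_fordLaplace₀_trivialZeros h hσ₁
  -- `D ≥ 0` (apply the hypothesis at `z = 2`)
  have hD0 : 0 ≤ D := by
    have h2 := hD 2 (by simp) (by simpa using hη)
    have h3 : (0 : ℝ) ≤ D / ‖(2 : ℂ)‖ ^ 2 := (norm_nonneg _).trans h2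
    rw [Complex.norm_two] at h3
    linarith
  have hterm : ∀ k : ℕ, ‖fordLaplace₀ f (s + 2 * ((k : ℂ) + 1))‖ ≤
      D * (1 / (2 * ((k : ℝ) + 1) + s.re) ^ 2) := by
    intro k
    have hn := norm_add_two_mul_ge s k
    have hpos : 0 < 2 * ((k : ℝ) + 1) + s.re := by linarith [hk0 k]
    have hz := hD (s + 2 * ((k : ℂ) + 1)) (by simp; linarith [hk0 k]) (by linarith [hk0 k])
    refine hz.trans ?_
    rw [mul_one_div]
    exact div_le_div_of_nonneg_left hD0 (by positivity) (by
      have := pow_le_pow_left₀ hpos.le hn 2; exact this)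
  have hdom : Summable fun k : ℕ ↦ D * (1 / (2 * ((k : ℝ) + 1) + s.re) ^ 2) := by
    refine Summable.mul_left D (summable_of_sum_range_le (fun _ ↦ by positivity)
      (sum_inv_sq_trivial_le hσ))
  calc ‖smoothedEFRemainder f s‖ = ‖-smoothedEFRemainder f s‖ := (norm_neg _).symm
    _ = ‖∑' k : ℕ, fordLaplace₀ f (s + 2 * ((k : ℂ) + 1))‖ := by rw [hHS.tsum_eq]
    _ ≤ ∑' k : ℕ, ‖fordLaplace₀ f (s + 2 * ((k : ℂ) + 1))‖ := norm_tsum_le_tsum_norm hsn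
    _ ≤ ∑' k : ℕ, D * (1 / (2 * ((k : ℝ) + 1) + s.re) ^ 2) := hsn.tsum_le_tsum hterm hdom
    _ = D * ∑' k : ℕ, 1 / (2 * ((k : ℝ) + 1) + s.re) ^ 2 := tsum_mul_left
    _ ≤ D * (1 / 4) := by
        refine mul_le_mul_of_nonneg_left ?_ hD0
        exact Real.tsum_le_of_sum_range_le (fun _ ↦ by positivity) (sum_inv_sq_trivial_le hσ)
    _ = D / 4 := by ring

end SmoothedEF

end Literature.NumberTheory.LFunctions
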